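import Literature.NumberTheory.Automorphic.IdeleClassCharacterGaloisOrbit
import Literature.NumberTheory.Automorphic.IdeleClassCharacterLocalFactors
import Literature.NumberTheory.Automorphic.AsaiAtOneRankOne
import Literature.NumberTheory.GaloisRepresentations.HeckeCharacterAutConj
import Literature.NumberTheory.GaloisRepresentations.AlgebraicHeckeCharacterPurity
import Literature.RepresentationTheory.HarrisKudlaSweet1996.SplittingCharactersCM
import HarnessLib

/-!
# The `Gal(ℂ/ℚ)`-conjugates `σμ` of an automorphic character `μ` of odd ∞-type
# ([Liu21] §4.1–4.2: the orbits indexing Cor. 4.20), as unitary idele class characters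

Topic `NumberTheory/Automorphic`; namespace `Literature.NumberTheory.Automorphic` (grouping sub-namespace
`IdeleClassGroup`, as in the companion files).  ONE definition with a body (`IdeleClassGroup.autConj`) and
theorems; **no named fact, no `sorry`** (D-0026).  Sequel of `IdeleClassCharacterAlgebraicTwist`
(`muAlg` = Liu's `μ^{alg}`, `muAlgValueField` = Liu's `M_μ`), of `IdeleClassCharacterGaloisOrbit` (the orbit of
the VALUES `μ^{alg}|_{(𝔸_E^∞)^×}` under `Aut(ℂ)`: stabiliser `Aut(ℂ/M_μ)`, `[M_μ:ℚ]` elements) and of the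
tree's Weil-1956 file `GaloisRepresentations/HeckeCharacterAutConj` (`HeckeCharacter.HasInfinityType.autConj`:
the conjugate `^σχ` of an algebraic Hecke character, `(^σχ)(x) = σ(χ(x))` for `x_∞ = 1`).

SOURCE.  Y. Liu, *Fourier–Jacobi cycles and arithmetic relative trace formula*, Camb. J. Math. **9** (2021)
= arXiv:2102.11518 [Liu2021]; TeX source `FJcycle.tex` (md5 `6db49a74122d…`), held extraction
`paper:arxiv-2102.11518` p0018, p0022–p0024.

AS PRINTED.  §4.1 (l. 1922–1927): "Now let `μ` be a conjugate symplectic automorphic character, which is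
not algebraic. We put `μ^{alg} ≔ μ · | |_E^{-1/2}`, which is then algebraic. Denote by `M_μ ⊆ ℂ` the subfield
generated by values `μ^{alg}(x)` for `x ∈ (𝔸_E^∞)^×` …".  Cor. 4.20 (l. 2307): "… where the product is taken
over representatives of `Gal(ℂ/ℚ)`-orbits of all conjugate symplectic automorphic characters of `𝔸_E^×` of
weight one."  L. 2314: "the `Gal(ℂ/ℚ)`-orbit of `μ`".  Proof of Thm. 4.18 (3), l. 2272: "`Gal(ℂ/M_μ)` stabilizes
`μ`".  The action meant is the standard one on automorphic characters that are algebraic up to the twist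
`|·|^{1/2}`: `σ ∈ Aut(ℂ)` sends `μ` to the unitary character `σμ` with `(σμ)^{alg} = ^σ(μ^{alg})`, i.e.
`(σμ)^{alg}(x) = σ(μ^{alg}(x))` on `(𝔸_E^∞)^×` (Weil 1956: the conjugate of a character of type `A₀` is of
type `A₀`).

WHAT IS HERE (`L` a totally complex number field, `ψ : IdeleClassGroup L →ₜ* Circle` of unitary ∞-type `e`
with every `e_w` odd — for a CM field exactly Liu's conjugate symplectic / weight-`𝔴` characters, `e = ∓𝔴`;
`σ : ℂ ≃ₐ[ℚ] ℂ`).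
* § 1 **weights**: the algebraic type `(p, q) = ((1−e)/2, (1+e)/2)` of `μ^{alg}` (`hasInfinityType_muAlg`) has
  `p_w + q_w = 1`, and so does its conjugate type `^σ(p, q)` (`add_autConjType_muAlg_eq_one`; purity of the
  tree, `HasInfinityType.embExponent_autConjType_add_conjugate_eq`).
* § 2 **unitarity**: `^σ(μ^{alg}) · ‖·‖^{1/2}` is a UNITARY Hecke character
  (`isUnitary_autConj_muAlg_mul_normSqrt`): it kills Weil's positive real ideles `z(r)`
  (`^σ(μ^{alg})(z(r)) = ∏_w r^{-(p'_w+q'_w)} = r^{-d}`, `‖z(r)‖^{1/2} = r^{d}`), and a Hecke character trivial on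
  `z(ℝ_{>0})` is unitary (`HeckeCharacter.isUnitary_of_map_posRealIdele`, compactness of `C_L¹`).
* § 3 **the conjugate character** `IdeleClassGroup.autConj σ ψ e he hodd : IdeleClassGroup L →ₜ* Circle` =: `σμ`
  (the circle-valued form of that unitary Hecke character), with `toHeckeCharacter_autConj`,
  **`muAlg_autConj : (σμ)^{alg} = ^σ(μ^{alg})`**, `coe_muAlg_autConj_apply_of_fst_eq_one`
  (`(σμ)^{alg}(x) = σ(μ^{alg}(x))` for `x_∞ = 1`), `valueAtUniformizer_muAlg_autConj`,
  **`muAlgValueField_autConj : M_{σμ} = σ(M_μ)`**, `autConj_one : 1μ = μ`.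
* § 4 **the ∞-type of `σμ`**: unitary ∞-type `e^σ = q' − p'` (`hasInfinityType_autConj`), again odd
  (`odd_autConjExp`), and of weight one if `μ` is (`autConjExp_eq_one_or_eq_neg_one`) — so for a CM field
  `σμ` is again a character "of weight one" in Liu's sense.
* § 5 **the orbit**: `autConj_eq_autConj_iff : σμ = τμ ↔ σ|_{M_μ} = τ|_{M_μ}`,
  **`autConj_eq_self_iff : σμ = μ ↔ σ ∈ Aut(ℂ/M_μ)`** ("`Gal(ℂ/M_μ)` stabilizes `μ`", l. 2272, now for the
  characters themselves), and **`natCard_range_autConj : |{σμ : σ ∈ Aut(ℂ)}| = [M_μ : ℚ]`** (through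
  `IdeleClassCharacterGaloisOrbit.natCard_orbit_muAlgFin_eq_finrank`).
  For conjugate symplectic `ψ` on a CM field: `IsConjugateSymplectic.autConj` and the same statements.

NOT HERE.  (i) `σμ` is again conjugate SYMPLECTIC (its restriction to `𝔸_F^×` is `μ_{E/F}`: the values of
`μ^{alg}` on `𝔸_{F}^{∞,×}` are `±‖·‖_F^{-1} ∈ ℚ`) and `Φ_{σμ} = σΦ_μ` — a sequel file.  (ii) "`d(μ,K)` depends
only on the orbit" (representation theory; CITE).  (iii) Characters with an even exponent (there `μ·|·|^{-1/2}`
is not algebraic and `Aut(ℂ)` does not act).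

## References

* [Liu2021] Y. Liu, *Fourier–Jacobi cycles and arithmetic relative trace formula*, Camb. J. Math. 9 (2021),
  no. 1, 1–147, arXiv:2102.11518 — §4.1 (TeX ll. 1922–1927), Cor. 4.20 (ll. 2301–2314), proof of
  Thm. 4.18 (3) (l. 2272).
* [Weil1956] A. Weil, *On a certain type of characters of the idèle-class group of an algebraic
  number-field*, Proc. Int. Symp. Tokyo–Nikko 1955 (1956), 1–7, §1 (conjugates of type-`A₀` characters).
* [Patrikis2019] S. Patrikis, *Variations on a theorem of Tate*, Mem. AMS 258 (2019), §2.1 (unitary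
  normalisation, Lemma 2.1.3 purity).
* [WeilBNT1967] A. Weil, *Basic Number Theory* (1967), Ch. IV §4 (the ideles `z(λ)`), Ch. VII §3.
-/

set_option autoImplicit false

noncomputable section

open scoped NNReal ComplexConjugate
open Cardinal
open NumberField IsDedekindDomain NumberField.InfinitePlace NumberField.InfinitePlace.Completion

namespace Literature.NumberTheory.Automorphic

open GaloisRepresentations
open Literature.RepresentationTheory.HarrisKudlaSweet1996 (unitaryClassChar coe_unitaryClassChar_mk
  toHeckeCharacter_unitaryClassChar hasUnitaryArchType_iff_hasInfinityType_unitaryClassChar)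

namespace IdeleClassGroup

variable {L : Type} [Field L] [NumberField L]

/-! ## § 1. Weights: `p_w + q_w = 1` for the type of `μ^{alg}` and for its conjugates -/

section Weights

variable [IsTotallyComplex L]

omit [NumberField L] in
/-- On a totally complex field every infinite place has `[L_w : ℝ] = 2`. [folklore] -/
private theorem mult_eq_two (w : InfinitePlace L) : w.mult = 2 := by
  rw [NumberField.InfinitePlace.mult, if_neg (not_isReal_iff_isComplex.2 (IsTotallyComplex.isComplex w))]

omit [NumberField L] [IsTotallyComplex L] in
/-- `(1 - e)/2 + (1 + e)/2 = 1` for odd `e`. [folklore] -/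
private theorem half_add_half_eq_one {e : ℤ} (he : Odd e) : (1 - e) / 2 + (1 + e) / 2 = 1 := by
  obtain ⟨k, rfl⟩ := he
  omega

/-- **Purity weight of `μ^{alg}`**: the exponents `n_φ` of the type `((1−e)/2, (1+e)/2)` of `μ^{alg}` satisfy
`n_φ + n_{φ̄} = 1` for every embedding `φ` (the weight of `μ^{alg}` is `1`).
[cite: Liu2021, §4.1, after Def. 4.3 (TeX ll. 1922–1926)] [cite: Patrikis2019, Lemma 2.1.3] -/
theorem embExponent_muAlgType_add_conjugate_eq_one {ψ : IdeleClassGroup L →ₜ* Circle}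
    {e : InfinitePlace L → ℤ} (he : HasInfinityType L ψ e) (hodd : ∀ w, Odd (e w)) (φ : L →+* ℂ) :
    HeckeCharacter.embExponent (fun w => (1 - e w) / 2) (fun w => (1 + e w) / 2) φ +
      HeckeCharacter.embExponent (fun w => (1 - e w) / 2) (fun w => (1 + e w) / 2)
        (ComplexEmbedding.conjugate φ) = 1 := by
  obtain ⟨wt, hwt⟩ := (hasInfinityType_muAlg he hodd).exists_embExponent_add_conjugate_eq
  obtain ⟨w₀⟩ := (inferInstance : Nonempty (InfinitePlace L))
  have h2 := HeckeCharacter.two_mul_add_eq_weight_mul_mult_of_embExponent hwt w₀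
  rw [mult_eq_two, half_add_half_eq_one (hodd w₀)] at h2
  have hwt1 : wt = 1 := by
    push_cast at h2
    omega
  rw [hwt φ, hwt1]

/-- **The conjugate type `^σ((1−e)/2, (1+e)/2)` again has `p'_w + q'_w = 1` at every place** (the weight is
`Aut(ℂ)`-invariant: tree `HasInfinityType.embExponent_autConjType_add_conjugate_eq`).
[cite: Patrikis2019, Lemma 2.1.3] [cite: Weil1956, §1] -/
theorem add_autConjType_muAlg_eq_one (σ : ℂ ≃ₐ[ℚ] ℂ) {ψ : IdeleClassGroup L →ₜ* Circle}
    {e : InfinitePlace L → ℤ} (he : HasInfinityType L ψ e) (hodd : ∀ w, Odd (e w)) (w : InfinitePlace L) :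
    (HeckeCharacter.autConjType σ (fun w => (1 - e w) / 2) (fun w => (1 + e w) / 2)).1 w +
      (HeckeCharacter.autConjType σ (fun w => (1 - e w) / 2) (fun w => (1 + e w) / 2)).2 w = 1 := by
  have h' := (hasInfinityType_muAlg he hodd).embExponent_autConjType_add_conjugate_eq σ
    (embExponent_muAlgType_add_conjugate_eq_one he hodd)
  have h2 := HeckeCharacter.two_mul_add_eq_weight_mul_mult_of_embExponent h' w
  rw [mult_eq_two] at h2
  push_cast at h2
  omega

end Weights

/-! ## § 2. `^σ(μ^{alg}) · ‖·‖^{1/2}` is unitary -/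

section Unitary

variable [IsTotallyComplex L]

omit [NumberField L] in
/-- On a totally complex field every infinite idele is totally positive (there are no real places).
[folklore] -/
private theorem isTotallyPositive_of_isTotallyComplex (x : (InfiniteAdeleRing L)ˣ) :
    InfiniteIdele.IsTotallyPositive x :=
  fun w hw => absurd hw (not_isReal_iff_isComplex.2 (IsTotallyComplex.isComplex w))

omit [NumberField L] [IsTotallyComplex L] in
/-- The `w`-component of Weil's archimedean unit `z(r)_∞` embeds as the real number `r`. [folklore] -/
private theorem extensionEmbedding_posRealUnit (r : ℝ≥0ˣ) (w : InfinitePlace L) :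
    extensionEmbedding w
        (((Units.map (realToInfiniteAdele L).toMonoidHom (Units.map NNReal.toRealHom.toMonoidHom r) :
            (InfiniteAdeleRing L)ˣ) : InfiniteAdeleRing L) w) = ((((r : ℝ≥0ˣ) : ℝ≥0) : ℝ) : ℂ) := by
  rw [Units.coe_map, Units.coe_map]
  exact extensionEmbedding_realToInfiniteAdele_apply L _ w

omit [NumberField L] [IsTotallyComplex L] in
/-- The `w`-component of `z(r)_∞` has norm `r`. [folklore] -/
private theorem norm_posRealUnit (r : ℝ≥0ˣ) (w : InfinitePlace L) :
    ‖((Units.map (realToInfiniteAdele L).toMonoidHom (Units.map NNReal.toRealHom.toMonoidHom r) :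
        (InfiniteAdeleRing L)ˣ) : InfiniteAdeleRing L) w‖ = (((r : ℝ≥0ˣ) : ℝ≥0) : ℝ) := by
  rw [← (isometry_extensionEmbedding w).norm_map_of_map_zero (map_zero _), extensionEmbedding_posRealUnit,
    Complex.norm_real, Real.norm_of_nonneg (NNReal.coe_nonneg _)]

omit [IsTotallyComplex L] in
/-- The archimedean factor of a type `(p, q)` with `p_w + q_w = 1` at Weil's idele `z(r)`:
`A_{p,q}(z(r)_∞) = ∏_w r⁻¹`. [folklore] -/
private theorem archFactor_posRealUnit {p q : InfinitePlace L → ℤ} (hpq : ∀ w, p w + q w = 1) (r : ℝ≥0ˣ) :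
    HeckeCharacter.archFactor p q
        (Units.map (realToInfiniteAdele L).toMonoidHom (Units.map NNReal.toRealHom.toMonoidHom r)) =
      ∏ _w : InfinitePlace L, ((((r : ℝ≥0ˣ) : ℝ≥0) : ℝ) : ℂ)⁻¹ := by
  rw [HeckeCharacter.archFactor_apply]
  refine Finset.prod_congr rfl fun w _ => ?_
  have hr : ((((r : ℝ≥0ˣ) : ℝ≥0) : ℝ) : ℂ) ≠ 0 := by exact_mod_cast r.ne_zero
  rw [extensionEmbedding_posRealUnit, Complex.conj_ofReal, ← zpow_add₀ hr,
    show -p w + -q w = -1 by linarith [hpq w], zpow_neg_one]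

/-- `‖z(r)‖^{1/2} = ∏_w r` on a totally complex field (`‖z(r)_w‖_w = r²` at each complex place). [folklore] -/
private theorem normSqrtCharacter_posRealIdele (r : ℝ≥0ˣ) :
    ((normSqrtCharacter L (posRealIdele L r) : ℂˣ) : ℂ) =
      ∏ _w : InfinitePlace L, ((((r : ℝ≥0ˣ) : ℝ≥0) : ℝ) : ℂ) := by
  rw [normSqrtCharacter_apply, posRealIdele_eq_infiniteIdeles, HeckeCharacter.ideleNorm_infiniteIdeles']
  simp_rw [mult_eq_two, norm_posRealUnit]
  rw [Finset.prod_pow, Real.sqrt_sq (Finset.prod_nonneg fun _ _ => NNReal.coe_nonneg _), Complex.ofReal_prod]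

/-- **`^σ(μ^{alg}) · ‖·‖^{1/2}` is unitary.**  For `ψ` of odd unitary ∞-type `e` on a totally complex `L` and
`σ ∈ Aut(ℂ)`, the Hecke character `^σ(μ^{alg}) · ‖·‖^{1/2}` — `^σ(μ^{alg})` Weil's conjugate of the algebraic
character `μ^{alg}` (`HeckeCharacter.HasInfinityType.autConj`) — is unitary: on Weil's ideles `z(r)`,
`r > 0`, it takes the value `∏_w r^{-(p'_w+q'_w)} · ∏_w r = 1` (§ 1), and a Hecke character trivial on
`z(ℝ_{>0})` is unitary (`HeckeCharacter.isUnitary_of_map_posRealIdele`).  This is the unitary normalisation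
`σμ` of the conjugate. [cite: Liu2021, §4.1 (TeX ll. 1922–1927) and Cor. 4.20 (l. 2307)] [cite: Weil1956, §1] -/
theorem isUnitary_autConj_muAlg_mul_normSqrt (σ : ℂ ≃ₐ[ℚ] ℂ) {ψ : IdeleClassGroup L →ₜ* Circle}
    {e : InfinitePlace L → ℤ} (he : HasInfinityType L ψ e) (hodd : ∀ w, Odd (e w)) :
    ((hasInfinityType_muAlg he hodd).autConj σ * normSqrtCharacter L).IsUnitary := by
  refine HeckeCharacter.isUnitary_of_map_posRealIdele fun r => ?_
  apply Units.ext
  rw [HeckeCharacter.mul_apply, Units.val_mul, Units.val_one, normSqrtCharacter_posRealIdele]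
  have hχ : (((hasInfinityType_muAlg he hodd).autConj σ) (posRealIdele L r) : ℂ) =
      ∏ _w : InfinitePlace L, ((((r : ℝ≥0ˣ) : ℝ≥0) : ℝ) : ℂ)⁻¹ := by
    rw [posRealIdele_eq_infiniteIdeles,
      ((hasInfinityType_muAlg he hodd).hasInfinityType_autConj σ).apply_infiniteIdeles_eq
        (isTotallyPositive_of_isTotallyComplex _)]
    exact archFactor_posRealUnit (add_autConjType_muAlg_eq_one σ he hodd) r
  rw [hχ, ← Finset.prod_mul_distrib]
  refine Finset.prod_eq_one fun w _ => inv_mul_cancel₀ ?_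
  exact_mod_cast r.ne_zero

end Unitary

/-! ## § 3. The conjugate character `σμ` -/

section AutConj

variable [IsTotallyComplex L]

/-- **The `Gal(ℂ/ℚ)`-conjugate `σμ` of an automorphic character of odd ∞-type** ([Liu21] Cor. 4.20: the
`Gal(ℂ/ℚ)`-orbits of conjugate symplectic automorphic characters; Weil 1956).  For `ψ = μ : C_L →ₜ* S¹` of
unitary ∞-type `e` with every `e_w` odd on a totally complex `L`, and `σ ∈ Aut(ℂ) = (ℂ ≃ₐ[ℚ] ℂ)`, this is the
UNITARY idele class character whose algebraic twist is Weil's conjugate of `μ^{alg}`: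
`(σμ)^{alg} = ^σ(μ^{alg})` (`muAlg_autConj`), i.e. `(σμ)^{alg}(x) = σ(μ^{alg}(x))` for every idele `x` with
`x_∞ = 1` — the circle-valued form (`unitaryClassChar`) of the unitary Hecke character `^σ(μ^{alg}) · ‖·‖^{1/2}`
(`isUnitary_autConj_muAlg_mul_normSqrt`). [cite: Liu2021, Cor. 4.20 (TeX ll. 2307–2314)] [cite: Weil1956, §1] -/
def autConj (σ : ℂ ≃ₐ[ℚ] ℂ) (ψ : IdeleClassGroup L →ₜ* Circle) (e : InfinitePlace L → ℤ)
    (he : HasInfinityType L ψ e) (hodd : ∀ w, Odd (e w)) : IdeleClassGroup L →ₜ* Circle :=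
  unitaryClassChar L ((hasInfinityType_muAlg he hodd).autConj σ * normSqrtCharacter L)
    (isUnitary_autConj_muAlg_mul_normSqrt σ he hodd)

variable (σ : ℂ ≃ₐ[ℚ] ℂ) {ψ : IdeleClassGroup L →ₜ* Circle} {e : InfinitePlace L → ℤ}
  (he : HasInfinityType L ψ e) (hodd : ∀ w, Odd (e w))

/-- `σμ` as a Hecke character is `^σ(μ^{alg}) · ‖·‖^{1/2}`. [cite: Liu2021, §4.1 (TeX l. 1922)] -/
theorem toHeckeCharacter_autConj :
    toHeckeCharacter L (autConj σ ψ e he hodd) = (hasInfinityType_muAlg he hodd).autConj σ * normSqrtCharacter L :=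
  toHeckeCharacter_unitaryClassChar L _ _

/-- **`(σμ)^{alg} = ^σ(μ^{alg})`**: the algebraic twist of the conjugate character is Weil's conjugate of the
algebraic twist. [cite: Liu2021, §4.1 (TeX ll. 1922–1927)] [cite: Weil1956, §1] -/
theorem muAlg_autConj : muAlg L (autConj σ ψ e he hodd) = (hasInfinityType_muAlg he hodd).autConj σ := by
  rw [muAlg, toHeckeCharacter_autConj, mul_inv_cancel_right]

/-- The value of `σμ` on the class of an idele: `(σμ)[x] = ^σ(μ^{alg})(x) · ‖x‖^{1/2}`. [cite: Liu2021, §4.1 (TeX l. 1922)] -/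
theorem coe_autConj_apply_mk (x : ideleGroup L) :
    ((autConj σ ψ e he hodd (x : IdeleClassGroup L) : Circle) : ℂ) =
      (((hasInfinityType_muAlg he hodd).autConj σ x : ℂˣ) : ℂ) *
        ((Real.sqrt (GaloisRepresentations.ideleNorm x) : ℝ) : ℂ) := by
  rw [← coe_toHeckeCharacter_apply, toHeckeCharacter_autConj, HeckeCharacter.mul_apply, Units.val_mul,
    normSqrtCharacter_apply]

/-- **`(σμ)^{alg}(x) = σ(μ^{alg}(x))` on the finite ideles** (`x_∞ = 1`). [cite: Liu2021, §4.1 (TeX ll. 1926–1927)] [cite: Weil1956, §1] -/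
theorem coe_muAlg_autConj_apply_of_fst_eq_one {x : ideleGroup L} (hx : (x : AdeleRing (𝓞 L) L).1 = 1) :
    ((muAlg L (autConj σ ψ e he hodd) x : ℂˣ) : ℂ) = σ ((muAlg L ψ x : ℂˣ) : ℂ) := by
  rw [muAlg_autConj]
  exact (hasInfinityType_muAlg he hodd).autConj_apply_of_fst_eq_one σ hx

/-- The value of `σμ` itself on the class of a finite idele: `(σμ)[x] = σ(μ^{alg}(x)) · ‖x‖^{1/2}`.
[cite: Liu2021, §4.1 (TeX ll. 1922–1927)] -/
theorem coe_autConj_apply_mk_of_fst_eq_one {x : ideleGroup L} (hx : (x : AdeleRing (𝓞 L) L).1 = 1) :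
    ((autConj σ ψ e he hodd (x : IdeleClassGroup L) : Circle) : ℂ) =
      σ ((muAlg L ψ x : ℂˣ) : ℂ) * ((Real.sqrt (GaloisRepresentations.ideleNorm x) : ℝ) : ℂ) := by
  rw [coe_autConj_apply_mk, (hasInfinityType_muAlg he hodd).autConj_apply_of_fst_eq_one σ hx]

/-- **`(σμ)^{alg}(ϖ_v) = σ(μ^{alg}(ϖ_v))`** at every finite place. [cite: Liu2021, §4.1 (TeX l. 1927)] [cite: Weil1956, §1] -/
theorem valueAtUniformizer_muAlg_autConj (v : HeightOneSpectrum (𝓞 L)) :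
    (muAlg L (autConj σ ψ e he hodd)).valueAtUniformizer v = σ ((muAlg L ψ).valueAtUniformizer v) := by
  rw [muAlg_autConj]
  exact (hasInfinityType_muAlg he hodd).valueAtUniformizer_autConj σ v

/-- `σμ` is unramified at `v` iff `μ` is. [cite: Weil1956, §1] -/
theorem isUnramifiedAt_toHeckeCharacter_autConj_iff (v : HeightOneSpectrum (𝓞 L)) :
    (toHeckeCharacter L (autConj σ ψ e he hodd)).IsUnramifiedAt v ↔ (toHeckeCharacter L ψ).IsUnramifiedAt v := by
  rw [← isUnramifiedAt_muAlg_iff, muAlg_autConj, (hasInfinityType_muAlg he hodd).isUnramifiedAt_autConj_iff,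
    isUnramifiedAt_muAlg_iff]

/-- **`M_{σμ} = σ(M_μ)`**: the field generated by the values of `(σμ)^{alg}` on the finite ideles is the image
under `σ` of Liu's `M_μ`. [cite: Liu2021, §4.1 (TeX ll. 1926–1927) and Remark 4.4] -/
theorem muAlgValueField_autConj :
    muAlgValueField L (autConj σ ψ e he hodd) = (muAlgValueField L ψ).map (σ : ℂ ≃ₐ[ℚ] ℂ).toRingEquiv.toRingHom := by
  rw [muAlgValueField, muAlgValueField, RingHom.map_field_closure, ← Set.range_comp]
  congr 1
  ext z
  simp only [Set.mem_range, Function.comp_apply]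
  constructor
  · rintro ⟨y, rfl⟩
    exact ⟨y, (coe_muAlg_autConj_apply_of_fst_eq_one σ he hodd y.2).symm⟩
  · rintro ⟨y, rfl⟩
    exact ⟨y, coe_muAlg_autConj_apply_of_fst_eq_one σ he hodd y.2⟩

/-- **`1μ = μ`**: conjugating by the identity gives back `μ` (`μ^{alg}(x) · ‖x‖^{1/2} = μ[x]` on the finite
ideles, and characters of `C_L` agreeing on the finite ideles are equal, `IdeleClassGroup.eq_of_eqOn_finiteIdeles`).
[cite: Liu2021, §4.1 (TeX l. 1922)] -/
theorem autConj_one : autConj 1 ψ e he hodd = ψ := by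
  refine eq_of_eqOn_finiteIdeles L _ _ fun x hx => ?_
  apply Circle.ext
  rw [mk_apply, coe_autConj_apply_mk_of_fst_eq_one 1 he hodd hx, AlgEquiv.one_apply, coe_muAlg_apply,
    inv_mul_cancel_right₀]
  have h := (normSqrtCharacter L x).ne_zero
  rwa [normSqrtCharacter_apply] at h

end AutConj

/-! ## § 4. The ∞-type of `σμ`: odd, and of weight one if `μ` is -/

section InfinityType

variable [IsTotallyComplex L]

omit [NumberField L] [IsTotallyComplex L] in
/-- `(z/|z|)^m · |z|^{i·0} = (z/|z|)^m`. [folklore] -/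
private theorem archUnitaryValue_zero_right (m : ℤ) (z : ℂ) : archUnitaryValue m 0 z = (z / (‖z‖ : ℂ)) ^ m := by
  rw [archUnitaryValue, Complex.ofReal_zero, zero_mul, Complex.cpow_zero, mul_one]

omit [NumberField L] [IsTotallyComplex L] in
/-- The complex identity behind the unitary normalisation: for `z ≠ 0` and `a + b = 1`,
`z^{-a} \bar z^{-b} |z| = (z/|z|)^{b-a}`. [folklore] -/
private theorem zpow_mul_conj_zpow_mul_norm {z : ℂ} (hz : z ≠ 0) {a b : ℤ} (hab : a + b = 1) :
    z ^ (-a) * conj z ^ (-b) * (‖z‖ : ℂ) = (z / (‖z‖ : ℂ)) ^ (b - a) := by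
  have hn : (‖z‖ : ℂ) ≠ 0 := by exact_mod_cast norm_ne_zero_iff.2 hz
  have hconj : conj z = (‖z‖ : ℂ) ^ (2 : ℤ) * z⁻¹ := by
    rw [eq_mul_inv_iff_mul_eq₀ hz, Complex.conj_mul', zpow_ofNat]
  rw [hconj, mul_zpow, inv_zpow', neg_neg, ← zpow_mul, div_zpow, div_eq_mul_inv, ← zpow_neg (‖z‖ : ℂ),
    show -(b - a) = 2 * -b + 1 by omega, zpow_add_one₀ hn, show b - a = -a + b by ring, zpow_add₀ hz]
  ring

omit [NumberField L] [IsTotallyComplex L] in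
/-- With `p, q ∈ {0, 1}`-valued types (weight one, `e_w = ±1`), every exponent `n_φ` is `0` or `1`. [folklore] -/
private theorem embExponent_eq_zero_or_eq_one {e : InfinitePlace L → ℤ} (h1 : ∀ w, e w = 1 ∨ e w = -1)
    (φ : L →+* ℂ) :
    HeckeCharacter.embExponent (fun w => (1 - e w) / 2) (fun w => (1 + e w) / 2) φ = 0 ∨
      HeckeCharacter.embExponent (fun w => (1 - e w) / 2) (fun w => (1 + e w) / 2) φ = 1 := by
  unfold HeckeCharacter.embExponent
  rcases h1 (InfinitePlace.mk φ) with h | h <;> simp only [h] <;> (try split_ifs) <;> omega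

variable (σ : ℂ ≃ₐ[ℚ] ℂ) {ψ : IdeleClassGroup L →ₜ* Circle} {e : InfinitePlace L → ℤ}
  (he : HasInfinityType L ψ e) (hodd : ∀ w, Odd (e w))

/-- **The ∞-type of `σμ`.**  If `μ^{alg}` has type `(p, q) = ((1−e)/2, (1+e)/2)` and `^σ(μ^{alg})` the conjugate
type `(p', q') = ^σ(p, q)` (`HeckeCharacter.autConjType`: the exponent of `φ` is that of `σ⁻¹ ∘ φ`), then `σμ`
has the unitary ∞-type `e^σ = q' − p'`: `(σμ)((u,1)) = ∏_w (ι_w u_w/|ι_w u_w|)^{q'_w − p'_w}`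
(`z^{-p'} \bar z^{-q'} |z| = (z/|z|)^{q'-p'}` as `p'_w + q'_w = 1`).  In Liu's normalisation the component of `σμ`
at `w` is `arg(z)^{-𝔴^σ_w}` with `𝔴^σ = p' − q'`. [cite: Liu2021, Remark 4.2 and Cor. 4.20 (TeX ll. 1909–1913, 2307)] [cite: Weil1956, §1] -/
theorem hasInfinityType_autConj :
    HasInfinityType L (autConj σ ψ e he hodd) fun w =>
      (HeckeCharacter.autConjType σ (fun w => (1 - e w) / 2) (fun w => (1 + e w) / 2)).2 w -
        (HeckeCharacter.autConjType σ (fun w => (1 - e w) / 2) (fun w => (1 + e w) / 2)).1 w := by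
  rw [autConj, ← hasUnitaryArchType_iff_hasInfinityType_unitaryClassChar]
  intro x
  rw [HeckeCharacter.mul_apply, Units.val_mul,
    ((hasInfinityType_muAlg he hodd).hasInfinityType_autConj σ).apply_infiniteIdeles_eq
      (isTotallyPositive_of_isTotallyComplex x),
    normSqrtCharacter_apply, HeckeCharacter.ideleNorm_infiniteIdeles', HeckeCharacter.archFactor_apply]
  simp_rw [mult_eq_two]
  rw [Finset.prod_pow, Real.sqrt_sq (Finset.prod_nonneg fun w _ => norm_nonneg _), Complex.ofReal_prod,
    ← Finset.prod_mul_distrib]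
  refine Finset.prod_congr rfl fun w _ => ?_
  have hz : extensionEmbedding w ((x : InfiniteAdeleRing L) w) ≠ 0 :=
    InfiniteIdele.extensionEmbedding_apply_ne_zero x w
  rw [← (isometry_extensionEmbedding w).norm_map_of_map_zero (map_zero _) ((x : InfiniteAdeleRing L) w),
    Pi.zero_apply, archUnitaryValue_zero_right]
  exact zpow_mul_conj_zpow_mul_norm hz (add_autConjType_muAlg_eq_one σ he hodd w)

include he hodd in
/-- **The ∞-type of `σμ` is again odd** (`q' − p' = 1 − 2p'`): `σμ` is again a character of the kind `μ^{alg}`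
is defined for (for a CM field: again of the conjugate symplectic parity, [Liu21] Remark 4.2).
[cite: Liu2021, Remark 4.2 (TeX ll. 1909–1913)] [cite: Weil1956, §1] -/
theorem odd_autConjExp (w : InfinitePlace L) :
    Odd ((HeckeCharacter.autConjType σ (fun w => (1 - e w) / 2) (fun w => (1 + e w) / 2)).2 w -
      (HeckeCharacter.autConjType σ (fun w => (1 - e w) / 2) (fun w => (1 + e w) / 2)).1 w) := by
  have h := add_autConjType_muAlg_eq_one σ he hodd w
  exact ⟨-(HeckeCharacter.autConjType σ (fun w => (1 - e w) / 2) (fun w => (1 + e w) / 2)).1 w, by omega⟩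

omit [IsTotallyComplex L] in
omit [NumberField L] in
/-- The first component of the conjugate type at `w` is the exponent of `σ⁻¹ ∘ σ_w` (definitional).
[folklore] -/
private theorem autConjType_fst_apply (p q : InfinitePlace L → ℤ) (w : InfinitePlace L) :
    (HeckeCharacter.autConjType σ p q).1 w =
      HeckeCharacter.embExponent p q (((σ.symm : ℂ ≃ₐ[ℚ] ℂ)).toAlgHom.toRingHom.comp w.embedding) :=
  rfl

include he hodd in
/-- **Weight one is preserved**: if `μ` is of weight one (`e_w = ±1` everywhere, [Liu21] Def. 4.3 (1)) then so
is `σμ` (`e^σ_w = ±1`): the exponents of `^σ(p, q)` are exponents of `(p, q)`, hence in `{0, 1}`, and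
`p'_w + q'_w = 1` — so the `Gal(ℂ/ℚ)`-orbit of a weight-one character consists of weight-one characters
(Cor. 4.20's index set). [cite: Liu2021, Def. 4.3 (1) and Cor. 4.20 (TeX ll. 1915–1917, 2307)] -/
theorem autConjExp_eq_one_or_eq_neg_one (h1 : ∀ w, e w = 1 ∨ e w = -1) (w : InfinitePlace L) :
    (HeckeCharacter.autConjType σ (fun w => (1 - e w) / 2) (fun w => (1 + e w) / 2)).2 w -
        (HeckeCharacter.autConjType σ (fun w => (1 - e w) / 2) (fun w => (1 + e w) / 2)).1 w = 1 ∨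
      (HeckeCharacter.autConjType σ (fun w => (1 - e w) / 2) (fun w => (1 + e w) / 2)).2 w -
        (HeckeCharacter.autConjType σ (fun w => (1 - e w) / 2) (fun w => (1 + e w) / 2)).1 w = -1 := by
  have hsum := add_autConjType_muAlg_eq_one σ he hodd w
  have hp := embExponent_eq_zero_or_eq_one h1 (((σ.symm : ℂ ≃ₐ[ℚ] ℂ)).toAlgHom.toRingHom.comp w.embedding)
  rw [← autConjType_fst_apply σ] at hp
  omega

end InfinityType

/-! ## § 5. The `Gal(ℂ/ℚ)`-orbit of `μ`: `σμ = τμ ↔ σ|_{M_μ} = τ|_{M_μ}`, and its cardinality `[M_μ : ℚ]` -/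

section Orbit

variable [IsTotallyComplex L] (σ : ℂ ≃ₐ[ℚ] ℂ) {ψ : IdeleClassGroup L →ₜ* Circle} {e : InfinitePlace L → ℤ}
  (he : HasInfinityType L ψ e) (hodd : ∀ w, Odd (e w))

/-- **`σμ = τμ` iff `σ` and `τ` agree on `M_μ`**: two conjugates of `μ` coincide iff the automorphisms agree on
Liu's field of values `M_μ` (`⇒`: compare `(σμ)^{alg} = (τμ)^{alg}` on the finite ideles, whose values generate
`M_μ`; `⇐`: the two unitary characters agree on the classes of all finite ideles, which determine a character of
`C_L`, `IdeleClassGroup.eq_of_eqOn_finiteIdeles`).  Hence the orbit of `μ` is in bijection with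
`Aut(ℂ)/Aut(ℂ/M_μ) ≃ Hom(M_μ, ℂ)`. [cite: Liu2021, Cor. 4.20 and proof of Thm. 4.18 (3) (TeX ll. 2272, 2307–2314)] -/
theorem autConj_eq_autConj_iff (τ : ℂ ≃ₐ[ℚ] ℂ) :
    autConj σ ψ e he hodd = autConj τ ψ e he hodd ↔ ∀ z ∈ muAlgValueField L ψ, σ z = τ z := by
  constructor
  · intro h
    have hfin : ∀ x : {x : ideleGroup L // (x : AdeleRing (𝓞 L) L).1 = 1},
        σ ((muAlg L ψ x.1 : ℂˣ) : ℂ) = τ ((muAlg L ψ x.1 : ℂˣ) : ℂ) := fun x => by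
      rw [← coe_muAlg_autConj_apply_of_fst_eq_one σ he hodd x.2,
        ← coe_muAlg_autConj_apply_of_fst_eq_one τ he hodd x.2, h]
    exact (ringEquiv_smul_muAlgFin_eq_iff L ψ (σ : ℂ ≃ₐ[ℚ] ℂ).toRingEquiv (τ : ℂ ≃ₐ[ℚ] ℂ).toRingEquiv).1
      (funext hfin)
  · intro h
    refine eq_of_eqOn_finiteIdeles L _ _ fun x hx => ?_
    apply Circle.ext
    rw [mk_apply, coe_autConj_apply_mk_of_fst_eq_one σ he hodd hx, coe_autConj_apply_mk_of_fst_eq_one τ he hodd hx,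
      h _ (coe_muAlg_mem_muAlgValueField L ψ hx)]

/-- **[Liu21], proof of Thm. 4.18 (3): "`Gal(ℂ/M_μ)` stabilizes `μ`" — and conversely.**  `σμ = μ` iff `σ` fixes
`M_μ` pointwise: the stabiliser of `μ` in `Aut(ℂ)` is exactly `Aut(ℂ/M_μ)`.
[cite: Liu2021, proof of Thm. 4.18 (3) (TeX l. 2272)] -/
theorem autConj_eq_self_iff : autConj σ ψ e he hodd = ψ ↔ ∀ z ∈ muAlgValueField L ψ, σ z = z := by
  have h := autConj_eq_autConj_iff σ he hodd 1
  rw [autConj_one] at h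
  exact h.trans (forall₂_congr fun z _ => Iff.rfl)

/-- The stabiliser form: `σμ = μ ↔ σ ∈ Aut(ℂ/M_μ)` (`fixingSubgroup` of `M_μ` for the action of `ℂ ≃+* ℂ`).
[cite: Liu2021, proof of Thm. 4.18 (3) (TeX l. 2272)] -/
theorem autConj_eq_self_iff_mem_fixingSubgroup :
    autConj σ ψ e he hodd = ψ ↔
      (σ : ℂ ≃ₐ[ℚ] ℂ).toRingEquiv ∈ fixingSubgroup (ℂ ≃+* ℂ) (muAlgValueField L ψ : Set ℂ) := by
  rw [autConj_eq_self_iff, mem_fixingSubgroup_iff]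
  rfl

/-- Every ring automorphism of `ℂ` is a `ℚ`-algebra automorphism. [folklore] -/
private theorem exists_toRingEquiv_eq (τ : ℂ ≃+* ℂ) : ∃ σ : ℂ ≃ₐ[ℚ] ℂ, (σ : ℂ ≃ₐ[ℚ] ℂ).toRingEquiv = τ :=
  ⟨AlgEquiv.ofRingEquiv (f := τ) fun q => by simp, RingEquiv.ext fun _ => rfl⟩

/-- **The `Gal(ℂ/ℚ)`-orbit of `μ` has exactly `[M_μ : ℚ]` elements** ([Liu21] Cor. 4.20: the isogeny
decomposition of the Albanese is indexed by representatives of these orbits; summing over all `μ` instead counts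
each `A_μ` with the multiplicity `[M_μ:ℚ]`).  Proof: `σ ↦ σμ` and `σ ↦ σ ∘ μ^{alg}|_{(𝔸_E^∞)^×}` have the same
fibres (`autConj_eq_autConj_iff`, `ringEquiv_smul_muAlgFin_eq_iff`), and the latter orbit has `[M_μ:ℚ]`
elements (`natCard_orbit_muAlgFin_eq_finrank` of `IdeleClassCharacterGaloisOrbit`). [cite: Liu2021, Cor. 4.20 (TeX ll. 2307–2314)] -/
theorem natCard_range_autConj :
    Nat.card (Set.range fun σ : ℂ ≃ₐ[ℚ] ℂ => autConj σ ψ e he hodd) =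
      Module.finrank ℚ (muAlgValueField L ψ) := by
  classical
  set F : {x : ideleGroup L // (x : AdeleRing (𝓞 L) L).1 = 1} → ℂ :=
    fun x => ((muAlg L ψ x.1 : ℂˣ) : ℂ) with hF
  -- same fibres
  have hker : ∀ σ τ : ℂ ≃ₐ[ℚ] ℂ, autConj σ ψ e he hodd = autConj τ ψ e he hodd ↔
      (σ : ℂ ≃ₐ[ℚ] ℂ).toRingEquiv • F = (τ : ℂ ≃ₐ[ℚ] ℂ).toRingEquiv • F := fun σ τ => by
    rw [autConj_eq_autConj_iff, hF, ringEquiv_smul_muAlgFin_eq_iff]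
    rfl
  -- the comparison map `σμ ↦ σ • F` on the range, through a chosen `σ`
  have hmem : ∀ g : Set.range (fun σ : ℂ ≃ₐ[ℚ] ℂ => autConj σ ψ e he hodd),
      ∃ σ : ℂ ≃ₐ[ℚ] ℂ, autConj σ ψ e he hodd = g.1 := fun g => g.2
  let r : Set.range (fun σ : ℂ ≃ₐ[ℚ] ℂ => autConj σ ψ e he hodd) → MulAction.orbit (ℂ ≃+* ℂ) F :=
    fun g => ⟨((hmem g).choose : ℂ ≃ₐ[ℚ] ℂ).toRingEquiv • F, MulAction.mem_orbit F _⟩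
  have hr : ∀ g, autConj (hmem g).choose ψ e he hodd = g.1 := fun g => (hmem g).choose_spec
  have hbij : Function.Bijective r := by
    constructor
    · intro g g' hgg'
      apply Subtype.ext
      rw [← hr g, ← hr g']
      exact (hker _ _).2 (congrArg Subtype.val hgg')
    · rintro ⟨_, ⟨τ, rfl⟩⟩
      obtain ⟨σ, hσ⟩ := exists_toRingEquiv_eq τ
      refine ⟨⟨autConj σ ψ e he hodd, σ, rfl⟩, Subtype.ext ?_⟩
      change ((hmem ⟨autConj σ ψ e he hodd, σ, rfl⟩).choose : ℂ ≃ₐ[ℚ] ℂ).toRingEquiv • F = τ • F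
      rw [← hσ]
      exact (hker _ _).1 (hr ⟨autConj σ ψ e he hodd, σ, rfl⟩)
  rw [Nat.card_eq_of_bijective r hbij]
  exact natCard_orbit_muAlgFin_eq_finrank he hodd

end Orbit

/-! ## § 6. Conjugate symplectic `μ` on a CM field ([Liu21] §4.1) -/

section CM

variable [IsCMField L] {ψ : IdeleClassGroup L →ₜ* Circle}

/-- **The `Gal(ℂ/ℚ)`-conjugate `σμ` of a conjugate symplectic automorphic character `μ`** ([Liu21] §4.1,
Cor. 4.20), through its canonical odd ∞-type `IsConjugateSymplectic.infinityType` ([Liu21] Remark 4.2).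
[cite: Liu2021, Cor. 4.20 (TeX ll. 2307–2314)] -/
def IsConjugateSymplectic.autConj (hψ : IsConjugateSymplectic L ψ) (σ : ℂ ≃ₐ[ℚ] ℂ) :
    IdeleClassGroup L →ₜ* Circle :=
  IdeleClassGroup.autConj σ ψ hψ.infinityType hψ.hasInfinityType_infinityType
    fun w => hψ.odd hψ.hasInfinityType_infinityType w

/-- `(σμ)^{alg}(x) = σ(μ^{alg}(x))` on the finite ideles, conjugate symplectic case. [cite: Liu2021, §4.1 (TeX ll. 1922–1927)] -/
theorem IsConjugateSymplectic.coe_muAlg_autConj_apply_of_fst_eq_one (hψ : IsConjugateSymplectic L ψ)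
    (σ : ℂ ≃ₐ[ℚ] ℂ) {x : ideleGroup L} (hx : (x : AdeleRing (𝓞 L) L).1 = 1) :
    ((muAlg L (hψ.autConj σ) x : ℂˣ) : ℂ) = σ ((muAlg L ψ x : ℂˣ) : ℂ) :=
  IdeleClassGroup.coe_muAlg_autConj_apply_of_fst_eq_one σ _ _ hx

/-- `M_{σμ} = σ(M_μ)`, conjugate symplectic case. [cite: Liu2021, §4.1 and Remark 4.4 (TeX ll. 1926–1933)] -/
theorem IsConjugateSymplectic.muAlgValueField_autConj (hψ : IsConjugateSymplectic L ψ) (σ : ℂ ≃ₐ[ℚ] ℂ) :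
    muAlgValueField L (hψ.autConj σ) = (muAlgValueField L ψ).map (σ : ℂ ≃ₐ[ℚ] ℂ).toRingEquiv.toRingHom :=
  IdeleClassGroup.muAlgValueField_autConj σ _ _

/-- **"`Gal(ℂ/M_μ)` stabilizes `μ`"** and conversely, conjugate symplectic case: `σμ = μ ↔ σ|_{M_μ} = id`.
[cite: Liu2021, proof of Thm. 4.18 (3) (TeX l. 2272)] -/
theorem IsConjugateSymplectic.autConj_eq_self_iff (hψ : IsConjugateSymplectic L ψ) (σ : ℂ ≃ₐ[ℚ] ℂ) :
    hψ.autConj σ = ψ ↔ ∀ z ∈ muAlgValueField L ψ, σ z = z :=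
  IdeleClassGroup.autConj_eq_self_iff σ _ _

/-- `σμ = τμ ↔ σ|_{M_μ} = τ|_{M_μ}`, conjugate symplectic case. [cite: Liu2021, Cor. 4.20 (TeX ll. 2307–2314)] -/
theorem IsConjugateSymplectic.autConj_eq_autConj_iff (hψ : IsConjugateSymplectic L ψ) (σ τ : ℂ ≃ₐ[ℚ] ℂ) :
    hψ.autConj σ = hψ.autConj τ ↔ ∀ z ∈ muAlgValueField L ψ, σ z = τ z :=
  IdeleClassGroup.autConj_eq_autConj_iff σ _ _ τ

/-- **[Liu21] Cor. 4.20 bookkeeping: the `Gal(ℂ/ℚ)`-orbit of a conjugate symplectic `μ` has `[M_μ : ℚ]`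
elements.** [cite: Liu2021, Cor. 4.20 (TeX ll. 2307–2314)] -/
theorem IsConjugateSymplectic.natCard_range_autConj (hψ : IsConjugateSymplectic L ψ) :
    Nat.card (Set.range fun σ : ℂ ≃ₐ[ℚ] ℂ => hψ.autConj σ) = Module.finrank ℚ (muAlgValueField L ψ) :=
  IdeleClassGroup.natCard_range_autConj _ _

end CM

end IdeleClassGroup

end Literature.NumberTheory.Automorphic

end
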